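import Summits.CriticalPhenomena.SAWScalingLimit.Theses.SAWZoomRigidity
import Summits.CriticalPhenomena.SAWScalingLimit.Theses.SAWRestrictionRigidity
import Summits.CriticalPhenomena.SAWScalingLimit.Theorems.SubseqIdentification.Negative.Necessity
import Summits.CriticalPhenomena.SAWScalingLimit.Theorems.SubseqIdentification.Negative.ProbabilityRedundant
import HarnessLib.Audit

/-!
# Crux `JointCompactness` (stmt-CriticalPhenomena-6502) — birth skeleton `Lines/birth.lean`

Route `SAWZoomRigidity` (rank-5 crux). Crux, BY NAME:
`Summit.CriticalPhenomena.SAWScalingLimit.Theses.SAWZoomRigidity.JointCompactness` —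
(a) JOINT sequential precompactness of the pushed-forward critical `δℤ²` SAW laws: every positive
null mesh sequence `δₙ` has a subsequence along which, for EVERY Dobrushin domain and EVERY endpoint
approximation simultaneously, `∫ f(γ.curve) dP^{D}_{δ_{φ n}} → ∫ f d(P D)` for one chordal family `P`;
(b) the set `Ω_SAW` of such joint subsequential limits is sequentially compact for domainwise weak
convergence.

## The line (the route's planned glued split "tightness + uniform-in-δ domain continuity + diagonal",
made kernel-checked)

A diagonal argument only ever handles COUNTABLY many indices `(D, a, b)`; the crux quantifies over all
Dobrushin domains and all endpoint approximations.  The line isolates exactly the two lattice inputs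
that bridge countable → all, WITHOUT asserting that any limit exists (so that `Ω_SAW` may stay
non-singleton — the slack the zoom-flow route is built on):

* `stub_eventualTight` — (T) eventual set-level tightness of the pushed critical SAW laws, per
  `(D, a, b)`; VERBATIM the shared support item `EventualTight` (stmt-CriticalPhenomena-1372, the `∃ δ₀`
  repair of the refuted all-`δ` statement stmt-0772; `Iff.rfl` pin below).  OPEN (no annulus-crossing
  bound at `x_c`).  Gives, by Prokhorov + Tychonoff over a countable family, joint subsequential limits
  along countably many indices (`exists_subseq_forall_tendsto`, PROVED below).
* `stub_endpointRobust` — (E) ENDPOINT ROBUSTNESS (asymptotic approximation-independence at the level of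
  test functions): for two endpoint approximations `(a, b)`, `(a', b')` of the same Dobrushin domain and
  every bounded continuous `f`, `∫ f dP^{D,a,b}_δ - ∫ f dP^{D,a',b'}_δ → 0` as `δ → 0⁺`.  The
  Kennedy–Lawler "boundary lattice effect" question, stated without any limit.  A CONSEQUENCE of
  conjunct (a) of the crux (`endpointRobust_of_partA`, PROVED below), hence exactly as safe as the crux.
  OPEN.
* `stub_countableNet` — (C) COUNTABLE DOMAIN NET (weak separability of the germs at `0⁺` of the
  lattice laws, uniformly over NO modulus): there is ONE sequence of endpoint-approximated Dobrushin
  domains `(Dₖ, aₖ, bₖ)` such that for every `(D, a, b)`, every test function `f` and every `ε > 0`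
  some member `k` has `|∫ f dP^{D,a,b}_δ - ∫ f dP^{Dₖ,aₖ,bₖ}_δ| ≤ ε` for all small `δ`.  This is the
  "countable dense class of domains" of the route header in the only form the diagonal argument
  consumes; it follows from the full LSW picture (`LimitExists` of route SAWRestrictionRigidity +
  separability of `ProbabilityMeasure (CurveClass ℂ)`, Billingsley Thm 6.8) but asserts no convergence.
  OPEN (needs the restriction squeeze `d_TV(P_{D⁻}, P_D) ≤ 2 P_D(γ ⊄ cl D⁻)` + boundary non-crawling,
  uniformly in small `δ`).

`JointCompactness_of (hT) (hE) (hC) : JointCompactness` is PROVED below (no sorry):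
(a) joint extraction along the net (T); every test integral along the extracted subsequence is CAUCHY by
comparison with the net (C), hence converges; the limit functional of the reference approximation
(`SAW.exists_isEndpointApprox`) is represented by a probability measure `P D` (a further extraction, (T));
all approximations of `D` have the same limits (E); chordality by the tree lemmas
`ae_endpoints_of_hyps` / `ae_range_subset_closure_of_hyps`.
(b) given `uₘ ∈ Ω_SAW` along mesh sequences `δ^m`, choose `nₘ` with `δ^m_{nₘ} < 1/(m+1)` and the pushed
laws at mesh `δ^m_{nₘ}` within `1/(m+1)` of `uₘ Dₖ` for `k ≤ m` in a compatible distance on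
`ProbabilityMeasure (CurveClass ℂ)` (the weak topology is pseudo-metrizable: Lévy–Prokhorov, Mathlib);
apply (a) to the diagonal mesh sequence: the joint limit `P ∈ Ω_SAW` satisfies `u_{φ j} Dₖ → P Dₖ`
for every `k`, and (C) passed to the limit (`|∫ f d(Q D) - ∫ f d(Q Dₖ)| ≤ ε` for every `Q ∈ Ω_SAW`)
extends this to every `D`.

Sorries: exactly 3 = the three `stub_*`; zero elsewhere.  Disproof used: none (no `Disproof.lean` on
this crux yet).  Negatives honoured: stmt-0772 (all-`δ` tightness, refuted) is NOT used — (T) is the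
`∃ δ₀` repair.  BC3 probes (planner folder `bc/probe_*.lean`): for each stub, `stub → JointCompactness`
and `stub → SAWScalingLimit` by `first | exact? | simpa | aesop` FAIL.
-/

noncomputable section

open MeasureTheory Filter Topology Set Metric Function
open Literature.Probability.RandomPlanarGeometry Literature.Probability.RandomPlanarGeometry.SAW
open Literature.Probability.LatticeModels
open scoped ENNReal NNReal BoundedContinuousFunction MeasureTheory Topology ProbabilityTheory

namespace Summit.CriticalPhenomena.SAWScalingLimit.Cruxes.JointCompactness.Birth

open Summit.CriticalPhenomena.SAWScalingLimit.Theses.SAWZoomRigidity (JointCompactness)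
open Summit.CriticalPhenomena.SAWScalingLimit.Theses.SAWRestrictionRigidity (EventualTight)
open Summit.CriticalPhenomena.SAWScalingLimit.Theorems.SubseqIdentification.Negative
  (eventually_isProbabilityMeasure_law ae_endpoints_of_hyps ae_range_subset_closure_of_hyps)

/-! ## The registered stubs -/

/-- **stub (T) — EVENTUAL TIGHTNESS** (verbatim the shared support item `EventualTight`,
stmt-CriticalPhenomena-1372): for every Dobrushin domain and endpoint approximation there is `δ₀ > 0`
such that the pushed-forward critical SAW laws for `δ ∈ (0, δ₀]` form a tight set of measures on
`CurveClass ℂ`.  OPEN: needs an annulus-crossing / no-macroscopic-oscillation bound for the critical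
SAW (Aizenman–Burchard regularity; Kemppainen–Smirnov Condition G2 is for FKG models).
Sources: KemppainenSmirnov2017 Thm 1.5, AizenmanBurchardDuke1999 Thm 1.1, DuminilCopinHammond2013. -/
theorem stub_eventualTight : ∀ (D : Literature.Probability.RandomPlanarGeometry.DobrushinDomain) (a b : ℝ → Literature.Probability.LatticeModels.Site 2), Literature.Probability.RandomPlanarGeometry.SAW.IsEndpointApprox D a b → ∃ δ₀ : ℝ, 0 < δ₀ ∧ MeasureTheory.IsTightMeasureSet ((fun δ => (Literature.Probability.RandomPlanarGeometry.SAW.law D.carrier δ (a δ) (b δ)).map (fun γ => γ.curve)) '' Set.Ioc 0 δ₀) := by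
  sorry

/-- **stub (E) — ENDPOINT ROBUSTNESS** (new; asymptotic approximation-independence, no limit asserted):
for one Dobrushin domain `D`, two endpoint approximations `(a, b)`, `(a', b')` and every bounded
continuous test function `f` on curve classes, the difference of the test integrals of the two pushed
critical SAW laws tends to `0` as `δ → 0⁺`.  The Kennedy–Lawler boundary-lattice-effect question for the
weak topology; a CONSEQUENCE of conjunct (a) of the crux (`endpointRobust_of_partA`).  OPEN: needs that a
microscopic change of the starting/ending vertex near the prime ends `a, b` does not change the bulk law
at `x_c` (no-crawling along `∂D` near the marked points).
Sources: KennedyLawler2013, LawlerSchrammWerner2004SAW §3.4, DuminilCopinHammond2013. -/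
theorem stub_endpointRobust : ∀ (D : Literature.Probability.RandomPlanarGeometry.DobrushinDomain) (a b a' b' : ℝ → Literature.Probability.LatticeModels.Site 2), Literature.Probability.RandomPlanarGeometry.SAW.IsEndpointApprox D a b → Literature.Probability.RandomPlanarGeometry.SAW.IsEndpointApprox D a' b' → ∀ f : BoundedContinuousFunction (Literature.Probability.RandomPlanarGeometry.CurveClass ℂ) ℝ, Filter.Tendsto (fun δ => ∫ γ, f γ.curve ∂(Literature.Probability.RandomPlanarGeometry.SAW.law D.carrier δ (a δ) (b δ)) - ∫ γ, f γ.curve ∂(Literature.Probability.RandomPlanarGeometry.SAW.law D.carrier δ (a' δ) (b' δ))) (nhdsWithin 0 (Set.Ioi 0)) (nhds 0) := by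
  sorry

/-- **stub (C) — COUNTABLE DOMAIN NET** (new; weak separability of the germs at `0⁺` of the lattice
laws): there is one sequence `(Dₖ, aₖ, bₖ)` of endpoint-approximated Dobrushin domains such that for
every endpoint-approximated Dobrushin domain `(D, a, b)`, every bounded continuous `f` and every `ε > 0`
some member `k` satisfies `|∫ f(γ.curve) dP^{D,a,b}_δ - ∫ f(γ.curve) dP^{Dₖ,aₖ,bₖ}_δ| ≤ ε` for all small
`δ > 0`.  The "countable dense class of domains" of the route header in exactly the form the diagonal
extraction consumes (no modulus of continuity, no domain topology).  Follows from the full LSW picture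
(full scaling limit for every domain + separability of the weak topology on probability measures over the
Polish space `CurveClass ℂ`, Billingsley Thm 6.8); OPEN as a lattice statement: intended from the exact
restriction squeeze `d_TV(P_{D⁻,δ}, P_{D,δ}) ≤ 2 P_{D,δ}(γ ⊄ cl D⁻)` for inner polygonal approximations with
rational vertices, boundary non-crawling and (E), uniformly in small `δ`.
Sources: LawlerSchrammWerner2004SAW §3.4.2, Smirnov2007ICM §2–3, BillingsleyCPM1999 Thm 6.8,
KennedyLawler2013. -/
theorem stub_countableNet : ∃ (Dn : ℕ → Literature.Probability.RandomPlanarGeometry.DobrushinDomain) (an bn : ℕ → ℝ → Literature.Probability.LatticeModels.Site 2), (∀ k, Literature.Probability.RandomPlanarGeometry.SAW.IsEndpointApprox (Dn k) (an k) (bn k)) ∧ ∀ (D : Literature.Probability.RandomPlanarGeometry.DobrushinDomain) (a b : ℝ → Literature.Probability.LatticeModels.Site 2), Literature.Probability.RandomPlanarGeometry.SAW.IsEndpointApprox D a b → ∀ (f : BoundedContinuousFunction (Literature.Probability.RandomPlanarGeometry.CurveClass ℂ) ℝ) (ε : ℝ), 0 < ε → ∃ k : ℕ, ∀ᶠ δ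 in nhdsWithin 0 (Set.Ioi 0), |∫ γ, f γ.curve ∂(Literature.Probability.RandomPlanarGeometry.SAW.law D.carrier δ (a δ) (b δ)) - ∫ γ, f γ.curve ∂(Literature.Probability.RandomPlanarGeometry.SAW.law (Dn k).carrier δ (an k δ) (bn k δ))| ≤ ε := by
  sorry

/-! ## Name-keyed aliases of the stub statements (skeleton-check convention: the hypotheses of
`JointCompactness_of` are exactly the declared stubs, each BY NAME) -/

namespace Registered

/-- Alias keyed by the stub name: the statement of `stub_eventualTight` (= item stmt-1372 `EventualTight`). -/
abbrev stub_eventualTight : Prop :=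
  ∀ (D : Literature.Probability.RandomPlanarGeometry.DobrushinDomain) (a b : ℝ → Literature.Probability.LatticeModels.Site 2), Literature.Probability.RandomPlanarGeometry.SAW.IsEndpointApprox D a b → ∃ δ₀ : ℝ, 0 < δ₀ ∧ MeasureTheory.IsTightMeasureSet ((fun δ => (Literature.Probability.RandomPlanarGeometry.SAW.law D.carrier δ (a δ) (b δ)).map (fun γ => γ.curve)) '' Set.Ioc 0 δ₀)

/-- Alias keyed by the stub name: the statement of `stub_endpointRobust` (new). -/
abbrev stub_endpointRobust : Prop :=
  ∀ (D : Literature.Probability.RandomPlanarGeometry.DobrushinDomain) (a b a' b' : ℝ → Literature.Probability.LatticeModels.Site 2), Literature.Probability.RandomPlanarGeometry.SAW.IsEndpointApprox D a b → Literature.Probability.RandomPlanarGeometry.SAW.IsEndpointApprox D a' b' → ∀ f : BoundedContinuousFunction (Literature.Probability.RandomPlanarGeometry.CurveClass ℂ) ℝ, Filter.Tendsto (fun δ => ∫ γ, f γ.curve ∂(Literature.Probability.RandomPlanarGeometry.SAW.law D.carrier δ (a δ) (b δ)) - ∫ γ, f γ.curve ∂(Literature.Probability.RandomPlanarGeometry.SAW.law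 D.carrier δ (a' δ) (b' δ))) (nhdsWithin 0 (Set.Ioi 0)) (nhds 0)

/-- Alias keyed by the stub name: the statement of `stub_countableNet` (new). -/
abbrev stub_countableNet : Prop :=
  ∃ (Dn : ℕ → Literature.Probability.RandomPlanarGeometry.DobrushinDomain) (an bn : ℕ → ℝ → Literature.Probability.LatticeModels.Site 2), (∀ k, Literature.Probability.RandomPlanarGeometry.SAW.IsEndpointApprox (Dn k) (an k) (bn k)) ∧ ∀ (D : Literature.Probability.RandomPlanarGeometry.DobrushinDomain) (a b : ℝ → Literature.Probability.LatticeModels.Site 2), Literature.Probability.RandomPlanarGeometry.SAW.IsEndpointApprox D a b → ∀ (f : BoundedContinuousFunction (Literature.Probability.RandomPlanarGeometry.CurveClass ℂ) ℝ) (ε : ℝ), 0 < ε → ∃ k : ℕ, ∀ᶠ δ in nhdsWithin 0 (Set.Ioi 0), |∫ γ, f γ.curve ∂(Literature.Probability.RandomPlanarGeometry.SAW.law D.carrier δ (a δ) (b δ)) - ∫ γ, f γ.curve ∂(Literature.Probability.RandomPlanarGeometry.SAW.law (Dn k).carrier δ (an k δ) (bn k δ))| ≤ ε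

end Registered

/-! ## The two conjuncts of the crux, verbatim (`jointCompactness_iff` is `Iff.rfl`) -/

/-- Conjunct (a) of `JointCompactness`: joint sequential precompactness. -/
abbrev PartA : Prop :=
  ∀ δ : ℕ → ℝ, (∀ n, 0 < δ n) → Filter.Tendsto δ Filter.atTop (nhds 0) → ∃ (φ : ℕ → ℕ) (P : Literature.Probability.RandomPlanarGeometry.ChordalFamily), StrictMono φ ∧ P.IsChordal ∧ ∀ (D : Literature.Probability.RandomPlanarGeometry.DobrushinDomain) (a b : ℝ → Literature.Probability.LatticeModels.Site 2), Literature.Probability.RandomPlanarGeometry.SAW.IsEndpointApprox D a b → ∀ f : BoundedContinuousFunction (Literature.Probability.RandomPlanarGeometry.CurveClass ℂ) ℝ, Filter.Tendsto (fun n => ∫ γ, f γ.curve ∂(Literature.Probability.RandomPlanarGeometry.SAW.law D.carrier (δ (φ n)) (a (δ (φ n))) (b (δ (φ n))))) Filter.atTop (nhds (∫ γ, f γ ∂(P D)))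

/-- Conjunct (b) of `JointCompactness`: sequential compactness of `Ω_SAW`. -/
abbrev PartB : Prop :=
  ∀ u : ℕ → Literature.Probability.RandomPlanarGeometry.ChordalFamily, (∀ m, (u m).IsChordal ∧ ∃ δ : ℕ → ℝ, (∀ n, 0 < δ n) ∧ Filter.Tendsto δ Filter.atTop (nhds 0) ∧ ∀ (D : Literature.Probability.RandomPlanarGeometry.DobrushinDomain) (a b : ℝ → Literature.Probability.LatticeModels.Site 2), Literature.Probability.RandomPlanarGeometry.SAW.IsEndpointApprox D a b → ∀ f : BoundedContinuousFunction (Literature.Probability.RandomPlanarGeometry.CurveClass ℂ) ℝ, Filter.Tendsto (fun n => ∫ γ, f γ.curve ∂(Literature.Probability.RandomPlanarGeometry.SAW.law D.carrier (δ n) (a (δ n)) (b (δ n)))) Filter.atTop (nhds (∫ γ, f γ ∂(u m D)))) → ∃ P : Literature.Probability.RandomPlanarGeometry.ChordalFamily, (P.IsChordal ∧ ∃ δ : ℕ → ℝ, (∀ n, 0 < δ n) ∧ Filter.Tendsto δ Filter.atTop (nhds 0) ∧ ∀ (D : Literature.Probability.RandomPlanarGeometry.DobrushinDomain) (a b : ℝ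 → Literature.Probability.LatticeModels.Site 2), Literature.Probability.RandomPlanarGeometry.SAW.IsEndpointApprox D a b → ∀ f : BoundedContinuousFunction (Literature.Probability.RandomPlanarGeometry.CurveClass ℂ) ℝ, Filter.Tendsto (fun n => ∫ γ, f γ.curve ∂(Literature.Probability.RandomPlanarGeometry.SAW.law D.carrier (δ n) (a (δ n)) (b (δ n)))) Filter.atTop (nhds (∫ γ, f γ ∂(P D)))) ∧ ∃ φ : ℕ → ℕ, StrictMono φ ∧ ∀ (D : Literature.Probability.RandomPlanarGeometry.DobrushinDomain) (f : BoundedContinuousFunction (Literature.Probability.RandomPlanarGeometry.CurveClass ℂ) ℝ), Filter.Tendsto (fun n => ∫ γ, f γ ∂(u (φ n) D)) Filter.atTop (nhds (∫ γ, f γ ∂(P D)))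

/-- The crux is literally `PartA ∧ PartB`. -/
theorem jointCompactness_iff : JointCompactness ↔ PartA ∧ PartB :=
  Iff.rfl

/-! ## Proved glue I: pushed-forward laws of a countable family and their probability surrogates -/

section Surrogate

/-- The critical SAW law of the `k`-th approximated domain at mesh `t`, pushed to curve classes. -/
def pushLaw (Dn : ℕ → DobrushinDomain) (an bn : ℕ → ℝ → Site 2) (t : ℝ) (k : ℕ) :
    Measure (CurveClass ℂ) :=
  (law (Dn k).carrier t (an k t) (bn k t)).map (fun γ => γ.curve)

open scoped Classical in
/-- Probability surrogate of `pushLaw`: the pushed law when it is a probability measure (all small `t`),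
a Dirac mass otherwise (junk meshes where `a_t, b_t` are not joined and `law = 0`). -/
def surrogate (Dn : ℕ → DobrushinDomain) (an bn : ℕ → ℝ → Site 2) (t : ℝ) (k : ℕ) :
    ProbabilityMeasure (CurveClass ℂ) :=
  if h : IsProbabilityMeasure (pushLaw Dn an bn t k) then ⟨pushLaw Dn an bn t k, h⟩
  else ⟨Measure.dirac (CurveClass.mk (Curve.const 0)), inferInstance⟩

variable {Dn : ℕ → DobrushinDomain} {an bn : ℕ → ℝ → Site 2}

/-- For all small meshes the surrogate IS the pushed-forward law. [folklore] -/
theorem eventually_coe_surrogate {k : ℕ} (hk : IsEndpointApprox (Dn k) (an k) (bn k)) :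
    ∀ᶠ t in 𝓝[>] (0 : ℝ), ((surrogate Dn an bn t k : ProbabilityMeasure (CurveClass ℂ)) :
      Measure (CurveClass ℂ)) = pushLaw Dn an bn t k := by
  filter_upwards [eventually_isProbabilityMeasure_law hk] with t ht
  haveI := ht
  have hp : IsProbabilityMeasure (pushLaw Dn an bn t k) :=
    Measure.isProbabilityMeasure_map (SAW.aemeasurable_curve _ _ _ _)
  rw [surrogate, dif_pos hp]
  rfl

/-- For all small meshes, test integrals against the surrogate are the SAW test integrals. [folklore] -/
theorem eventually_integral_surrogate {k : ℕ} (hk : IsEndpointApprox (Dn k) (an k) (bn k))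
    (f : CurveClass ℂ →ᵇ ℝ) :
    ∀ᶠ t in 𝓝[>] (0 : ℝ), ∫ x, f x ∂((surrogate Dn an bn t k : ProbabilityMeasure (CurveClass ℂ)) :
      Measure (CurveClass ℂ)) = ∫ γ, f γ.curve ∂(law (Dn k).carrier t (an k t) (bn k t)) := by
  filter_upwards [eventually_coe_surrogate hk] with t ht
  rw [ht, pushLaw]
  exact integral_map (SAW.aemeasurable_curve _ _ _ _) f.continuous.aestronglyMeasurable

/-- For all small meshes the surrogate lies in the tight image set of stub (T). [folklore] -/
theorem eventually_coe_surrogate_mem {k : ℕ} (hk : IsEndpointApprox (Dn k) (an k) (bn k)) {δ₀ : ℝ}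
    (hδ₀ : 0 < δ₀) :
    ∀ᶠ t in 𝓝[>] (0 : ℝ), ((surrogate Dn an bn t k : ProbabilityMeasure (CurveClass ℂ)) :
      Measure (CurveClass ℂ)) ∈ (fun δ => (law (Dn k).carrier δ (an k δ) (bn k δ)).map
        (fun γ => γ.curve)) '' Set.Ioc 0 δ₀ := by
  filter_upwards [eventually_coe_surrogate hk, Ioc_mem_nhdsGT hδ₀] with t ht htI
  rw [ht]
  exact ⟨t, htI, rfl⟩

end Surrogate

/-! ## Proved glue II: joint extraction along a COUNTABLE family (Prokhorov + Tychonoff) -/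

/-- **Joint subsequential limits along countably many indices.**  Under stub (T): for every sequence
`(Dₖ, aₖ, bₖ)` of endpoint-approximated Dobrushin domains and every mesh sequence `sₙ → 0⁺` there are ONE
subsequence `φ` and probability measures `νₖ` with `∫ f(γ.curve) dP^{Dₖ}_{s_{φ n}} → ∫ f dνₖ` for every
`k` and every bounded continuous `f`.  Proof: the surrogates `(surrogate (sₙ) k)ₖ` form a sequence in
the product over `k` of the compact sets "closure of the tight image (Prokhorov,
`isCompact_closure_of_isTightMeasureSet`) ∪ finitely many early terms"; the product is compact
(Tychonoff) and first countable (the weak topology is pseudo-metrizable), so a subsequence converges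
coordinatewise.  No hand-made diagonal. [cite: BillingsleyCPM1999, Thm. 5.1] -/
theorem exists_subseq_forall_tendsto (hT : Registered.stub_eventualTight)
    (Dn : ℕ → DobrushinDomain) (an bn : ℕ → ℝ → Site 2)
    (hn : ∀ k, IsEndpointApprox (Dn k) (an k) (bn k))
    {s : ℕ → ℝ} (hs : Tendsto s atTop (𝓝[>] (0 : ℝ))) :
    ∃ (φ : ℕ → ℕ) (ν : ℕ → Measure (CurveClass ℂ)), StrictMono φ ∧
      (∀ k, IsProbabilityMeasure (ν k)) ∧
      ∀ (k : ℕ) (f : CurveClass ℂ →ᵇ ℝ), Tendsto (fun n => ∫ γ, f γ.curve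
        ∂(law (Dn k).carrier (s (φ n)) (an k (s (φ n))) (bn k (s (φ n))))) atTop
        (𝓝 (∫ x, f x ∂(ν k))) := by
  classical
  choose δ₀ hδ₀ htight using fun k => hT (Dn k) (an k) (bn k) (hn k)
  -- the tight image sets, seen in `ProbabilityMeasure`, have compact closure (Prokhorov)
  obtain ⟨S, hS⟩ : ∃ S : ℕ → Set (ProbabilityMeasure (CurveClass ℂ)), ∀ k, S k =
      {μ : ProbabilityMeasure (CurveClass ℂ) | (μ : Measure (CurveClass ℂ)) ∈
        (fun δ => (law (Dn k).carrier δ (an k δ) (bn k δ)).map (fun γ => γ.curve)) ''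
          Set.Ioc 0 (δ₀ k)} := ⟨_, fun _ => rfl⟩
  have hSc : ∀ k, IsCompact (closure (S k)) := by
    intro k
    apply isCompact_closure_of_isTightMeasureSet
    refine (htight k).subset ?_
    rintro _ ⟨μ, hμ, rfl⟩
    rw [hS] at hμ
    exact hμ
  -- the surrogates are eventually in `S k`
  have hVS : ∀ k, ∀ᶠ n in atTop, surrogate Dn an bn (s n) k ∈ S k := by
    intro k
    filter_upwards [hs.eventually (eventually_coe_surrogate_mem (hn k) (hδ₀ k))] with n hn'
    rw [hS]
    exact hn'
  choose N hN using fun k => eventually_atTop.1 (hVS k)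
  -- compact coordinate sets containing ALL terms
  obtain ⟨K, hK⟩ : ∃ K : ℕ → Set (ProbabilityMeasure (CurveClass ℂ)), ∀ k, K k =
      closure (S k) ∪ (fun n => surrogate Dn an bn (s n) k) '' Set.Iio (N k) := ⟨_, fun _ => rfl⟩
  have hKc : ∀ k, IsCompact (K k) := fun k => by
    rw [hK]
    exact (hSc k).union ((Set.finite_Iio (N k)).image _).isCompact
  have hmem : ∀ n, (fun k => surrogate Dn an bn (s n) k) ∈ Set.pi Set.univ K := by
    intro n k _
    rw [hK]
    by_cases hnk : n < N k
    · exact Or.inr ⟨n, hnk, rfl⟩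
    · exact Or.inl (subset_closure (hN k n (not_lt.1 hnk)))
  obtain ⟨ν, -, φ, hφ, hlim⟩ := (isCompact_univ_pi hKc).tendsto_subseq hmem
  refine ⟨φ, fun k => (ν k : Measure (CurveClass ℂ)), hφ, fun k => inferInstance, fun k f => ?_⟩
  have hk : Tendsto (fun n => surrogate Dn an bn (s (φ n)) k) atTop (𝓝 (ν k)) :=
    tendsto_pi_nhds.1 hlim k
  have hk' := ProbabilityMeasure.tendsto_iff_forall_integral_tendsto.1 hk f
  refine hk'.congr' ?_
  exact (hs.comp hφ.tendsto_atTop).eventually (eventually_integral_surrogate (hn k) f)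

/-! ## Conjunct (a) from (T), (E), (C) -/

/-- **Joint sequential precompactness from (T), (E), (C).**  Extract jointly along the countable net
(T); every test integral along the extracted subsequence is Cauchy by comparison with the net (C), hence
convergent; represent the limit functional of the reference approximation of each domain by a
probability measure (a further extraction, (T), and uniqueness of limits); all approximations share the
limits (E); chordality is automatic for subsequential limits (tree lemmas). [folklore] -/
theorem partA_of (hT : Registered.stub_eventualTight) (hE : Registered.stub_endpointRobust)
    (hC : Registered.stub_countableNet) : PartA := by
  classical
  intro δ hpos hδ
  have hs : Tendsto δ atTop (𝓝[>] (0 : ℝ)) :=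
    tendsto_nhdsWithin_iff.2 ⟨hδ, Eventually.of_forall fun n => Set.mem_Ioi.2 (hpos n)⟩
  obtain ⟨Dn, an, bn, hn, hnet⟩ := hC
  -- (1) joint extraction along the countable net
  obtain ⟨φ, ν, hφ, hνp, hν⟩ := exists_subseq_forall_tendsto hT Dn an bn hn hs
  have hsφ : Tendsto (δ ∘ φ) atTop (𝓝[>] (0 : ℝ)) := hs.comp hφ.tendsto_atTop
  -- (2) along `δ ∘ φ` EVERY test integral converges: it is Cauchy by comparison with the net
  have hconv : ∀ (D : DobrushinDomain) (a b : ℝ → Site 2), IsEndpointApprox D a b →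
      ∀ f : CurveClass ℂ →ᵇ ℝ, ∃ l : ℝ, Tendsto (fun n => ∫ γ, f γ.curve
        ∂(law D.carrier (δ (φ n)) (a (δ (φ n))) (b (δ (φ n))))) atTop (𝓝 l) := by
    intro D a b hab f
    refine cauchySeq_tendsto_of_complete (Metric.cauchySeq_iff'.2 fun ε hε => ?_)
    obtain ⟨k, hk⟩ := hnet D a b hab f (ε / 4) (by positivity)
    have h1 : ∀ᶠ n in atTop, |∫ γ, f γ.curve ∂(law D.carrier (δ (φ n)) (a (δ (φ n))) (b (δ (φ n)))) -
        ∫ γ, f γ.curve ∂(law (Dn k).carrier (δ (φ n)) (an k (δ (φ n))) (bn k (δ (φ n))))| ≤ ε / 4 :=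
      hsφ.eventually hk
    have h2 : ∀ᶠ n in atTop, dist (∫ γ, f γ.curve
        ∂(law (Dn k).carrier (δ (φ n)) (an k (δ (φ n))) (bn k (δ (φ n))))) (∫ x, f x ∂(ν k)) < ε / 4 :=
      Metric.tendsto_nhds.1 (hν k f) _ (by positivity)
    obtain ⟨M, hM⟩ := eventually_atTop.1 (h1.and h2)
    refine ⟨M, fun n hn' => ?_⟩
    obtain ⟨hn1, hn2⟩ := hM n hn'
    obtain ⟨hM1, hM2⟩ := hM M le_rfl
    rw [Real.dist_eq] at hn2 hM2 ⊢
    rw [abs_le] at hn1 hM1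
    rw [abs_lt] at hn2 hM2 ⊢
    constructor <;> linarith
  choose lim hlim using hconv
  -- (3) reference approximation of each domain; its limit functional is a probability measure
  choose a₀ b₀ hab₀ using fun D : DobrushinDomain => SAW.exists_isEndpointApprox D
  have hrep : ∀ D : DobrushinDomain, ∃ μ : Measure (CurveClass ℂ), IsProbabilityMeasure μ ∧
      ∀ f : CurveClass ℂ →ᵇ ℝ, Tendsto (fun n => ∫ γ, f γ.curve
        ∂(law D.carrier (δ (φ n)) (a₀ D (δ (φ n))) (b₀ D (δ (φ n))))) atTop (𝓝 (∫ x, f x ∂μ)) := by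
    intro D
    obtain ⟨ψ, μ, hψ, hμp, hμ⟩ := exists_subseq_forall_tendsto hT (fun _ => D) (fun _ => a₀ D)
      (fun _ => b₀ D) (fun _ => hab₀ D) hsφ
    refine ⟨μ 0, hμp 0, fun f => ?_⟩
    have h1 := hlim D (a₀ D) (b₀ D) (hab₀ D) f
    have h2 : Tendsto (fun n => ∫ γ, f γ.curve ∂(law D.carrier (δ (φ (ψ n))) (a₀ D (δ (φ (ψ n))))
        (b₀ D (δ (φ (ψ n)))))) atTop (𝓝 (∫ x, f x ∂(μ 0))) := hμ 0 f
    have h3 : Tendsto (fun n => ∫ γ, f γ.curve ∂(law D.carrier (δ (φ (ψ n))) (a₀ D (δ (φ (ψ n))))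
        (b₀ D (δ (φ (ψ n)))))) atTop (𝓝 (lim D (a₀ D) (b₀ D) (hab₀ D) f)) := h1.comp hψ.tendsto_atTop
    rwa [tendsto_nhds_unique h3 h2] at h1
  choose P hPp hP using hrep
  -- (4) every approximation of `D` has the same limits (endpoint robustness)
  have hPall : ∀ (D : DobrushinDomain) (a b : ℝ → Site 2), IsEndpointApprox D a b →
      ∀ f : CurveClass ℂ →ᵇ ℝ, Tendsto (fun n => ∫ γ, f γ.curve
        ∂(law D.carrier (δ (φ n)) (a (δ (φ n))) (b (δ (φ n))))) atTop (𝓝 (∫ x, f x ∂(P D))) := by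
    intro D a b hab f
    have h1 : Tendsto (fun n => ∫ γ, f γ.curve ∂(law D.carrier (δ (φ n)) (a (δ (φ n))) (b (δ (φ n)))) -
        ∫ γ, f γ.curve ∂(law D.carrier (δ (φ n)) (a₀ D (δ (φ n))) (b₀ D (δ (φ n))))) atTop (𝓝 0) :=
      (hE D a b (a₀ D) (b₀ D) hab (hab₀ D) f).comp hsφ
    have h2 := h1.add (hP D f)
    rw [zero_add] at h2
    refine h2.congr fun n => ?_
    simp only [sub_add_cancel]
  -- (5) conclusion; chordality of the reference subsequential limits by the tree lemmas
  refine ⟨φ, P, hφ, fun D => ⟨hPp D, ?_⟩, hPall⟩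
  haveI := hPp D
  filter_upwards [ae_endpoints_of_hyps (hab₀ D) hsφ (hP D),
    ae_range_subset_closure_of_hyps (hab₀ D) hsφ (hP D)] with γ h1 h2
  exact ⟨h1.1, h1.2, h2⟩

/-! ## Conjunct (b) from (T), (C) and conjunct (a) -/

/-- Passing stub (C) to the limit: for every `Q ∈ Ω_SAW` (joint limit along `s`),
`|∫ f d(Q D) - ∫ f d(Q Dₖ)| ≤ ε` whenever the lattice test integrals of `D` and of the net member `k`
are eventually `ε`-close. [folklore] -/
theorem abs_integral_sub_le_of_net {Dn : ℕ → DobrushinDomain} {an bn : ℕ → ℝ → Site 2} {k : ℕ}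
    (hk : IsEndpointApprox (Dn k) (an k) (bn k)) (Q : ChordalFamily) {s : ℕ → ℝ}
    (hs : Tendsto s atTop (𝓝[>] (0 : ℝ)))
    (hQ : ∀ (D : DobrushinDomain) (a b : ℝ → Site 2), IsEndpointApprox D a b →
      ∀ f : CurveClass ℂ →ᵇ ℝ, Tendsto (fun n => ∫ γ, f γ.curve
        ∂(law D.carrier (s n) (a (s n)) (b (s n)))) atTop (𝓝 (∫ x, f x ∂(Q D))))
    {D : DobrushinDomain} {a b : ℝ → Site 2} (hab : IsEndpointApprox D a b) (f : CurveClass ℂ →ᵇ ℝ)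
    {ε : ℝ} (hε : ∀ᶠ t in 𝓝[>] (0 : ℝ), |∫ γ, f γ.curve ∂(law D.carrier t (a t) (b t)) -
      ∫ γ, f γ.curve ∂(law (Dn k).carrier t (an k t) (bn k t))| ≤ ε) :
    |∫ x, f x ∂(Q D) - ∫ x, f x ∂(Q (Dn k))| ≤ ε := by
  have h3 : Tendsto (fun n => |∫ γ, f γ.curve ∂(law D.carrier (s n) (a (s n)) (b (s n))) -
      ∫ γ, f γ.curve ∂(law (Dn k).carrier (s n) (an k (s n)) (bn k (s n)))|) atTop
      (𝓝 |∫ x, f x ∂(Q D) - ∫ x, f x ∂(Q (Dn k))|) :=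
    ((hQ D a b hab f).sub (hQ (Dn k) (an k) (bn k) hk f)).abs
  exact le_of_tendsto h3 (hs.eventually hε)

/-- **Sequential compactness of `Ω_SAW` from (C) and conjunct (a).**  Given `uₘ ∈ Ω_SAW` along
mesh sequences `δ^m`, pick `nₘ` with `δ^m_{nₘ} < 1/(m+1)` and the pushed laws of the net members `k ≤ m`
at that mesh within `1/(m+1)` of `uₘ Dₖ` for a compatible distance on `ProbabilityMeasure (CurveClass ℂ)`
(pseudo-metrizable weak topology, Lévy–Prokhorov); conjunct (a) applied to the diagonal mesh sequence
yields `P ∈ Ω_SAW` with `u_{φ j} Dₖ → P Dₖ` for all `k`; (C) in the limit extends to every `D`.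
[cite: BillingsleyCPM1999, Thm. 6.8] -/
theorem partB_of (hC : Registered.stub_countableNet) (hA : PartA) : PartB := by
  classical
  intro u hu
  have huch : ∀ m, (u m).IsChordal := fun m => (hu m).1
  choose δu hupos hutend huconv using fun m => (hu m).2
  obtain ⟨Dn, an, bn, hn, hnet⟩ := hC
  have hsu : ∀ m, Tendsto (δu m) atTop (𝓝[>] (0 : ℝ)) := fun m =>
    tendsto_nhdsWithin_iff.2 ⟨hutend m, Eventually.of_forall fun n => Set.mem_Ioi.2 (hupos m n)⟩
  -- a compatible distance on probability measures (the weak topology is pseudo-metrizable)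
  letI : PseudoMetricSpace (ProbabilityMeasure (CurveClass ℂ)) :=
    TopologicalSpace.pseudoMetrizableSpacePseudoMetric _
  -- the members `u m (Dn k)` as probability measures
  obtain ⟨U, hU⟩ : ∃ U : ℕ → ℕ → ProbabilityMeasure (CurveClass ℂ), ∀ m k,
      ((U m k : ProbabilityMeasure (CurveClass ℂ)) : Measure (CurveClass ℂ)) = u m (Dn k) :=
    ⟨fun m k => ⟨u m (Dn k), (huch m (Dn k)).1⟩, fun _ _ => rfl⟩
  -- the surrogates along `δ^m` converge to `u m (Dn k)`
  have hWU : ∀ m k, Tendsto (fun n => surrogate Dn an bn (δu m n) k) atTop (𝓝 (U m k)) := by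
    intro m k
    refine ProbabilityMeasure.tendsto_iff_forall_integral_tendsto.2 fun f => ?_
    rw [hU]
    refine (huconv m (Dn k) (an k) (bn k) (hn k) f).congr' ?_
    filter_upwards [(hsu m).eventually (eventually_integral_surrogate (hn k) f)] with n hn'
    exact hn'.symm
  -- diagonal choice of `nₘ`
  have hchoice : ∀ m : ℕ, ∃ n : ℕ, δu m n < 1 / ((m : ℝ) + 1) ∧
      ∀ k ∈ Set.Iic m, dist (surrogate Dn an bn (δu m n) k) (U m k) < 1 / ((m : ℝ) + 1) := by
    intro m
    have h1 : ∀ᶠ n in atTop, δu m n < 1 / ((m : ℝ) + 1) :=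
      (hutend m).eventually (gt_mem_nhds (by positivity))
    have h2 : ∀ᶠ n in atTop, ∀ k ∈ Set.Iic m,
        dist (surrogate Dn an bn (δu m n) k) (U m k) < 1 / ((m : ℝ) + 1) :=
      (eventually_all_finite (Set.finite_Iic m)).2 fun k _ =>
        Metric.tendsto_nhds.1 (hWU m k) _ (by positivity)
    exact (h1.and h2).exists
  choose nm hnm1 hnm2 using hchoice
  -- the diagonal mesh sequence `δ' m = δ^m_{nₘ}`
  obtain ⟨δ', hδ'⟩ : ∃ δ' : ℕ → ℝ, ∀ m, δ' m = δu m (nm m) := ⟨_, fun _ => rfl⟩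
  have hpos' : ∀ m, 0 < δ' m := fun m => by rw [hδ']; exact hupos m (nm m)
  have hδ'0 : Tendsto δ' atTop (𝓝 0) :=
    squeeze_zero (fun m => (hpos' m).le) (fun m => by rw [hδ']; exact (hnm1 m).le)
      tendsto_one_div_add_atTop_nhds_zero_nat
  have hnm2' : ∀ m, ∀ k ∈ Set.Iic m, dist (surrogate Dn an bn (δ' m) k) (U m k) < 1 / ((m : ℝ) + 1) :=
    fun m k hk => by rw [hδ']; exact hnm2 m k hk
  -- conjunct (a) along the diagonal sequence
  obtain ⟨φ, P, hφ, hPch, hPconv⟩ := hA δ' hpos' hδ'0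
  have hsφ : Tendsto (δ' ∘ φ) atTop (𝓝[>] (0 : ℝ)) :=
    (tendsto_nhdsWithin_iff.2 ⟨hδ'0, Eventually.of_forall fun m => Set.mem_Ioi.2 (hpos' m)⟩).comp
      hφ.tendsto_atTop
  have hPmem : ∀ (D : DobrushinDomain) (a b : ℝ → Site 2), IsEndpointApprox D a b →
      ∀ f : CurveClass ℂ →ᵇ ℝ, Tendsto (fun j => ∫ γ, f γ.curve
        ∂(law D.carrier ((δ' ∘ φ) j) (a ((δ' ∘ φ) j)) (b ((δ' ∘ φ) j)))) atTop (𝓝 (∫ x, f x ∂(P D))) :=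
    fun D a b hab f => hPconv D a b hab f
  -- (i) convergence on the net: `u (φ j) (Dn k) → P (Dn k)`
  have hnetconv : ∀ (k : ℕ) (f : CurveClass ℂ →ᵇ ℝ),
      Tendsto (fun j => ∫ x, f x ∂(u (φ j) (Dn k))) atTop (𝓝 (∫ x, f x ∂(P (Dn k)))) := by
    intro k
    obtain ⟨PM, hPM⟩ : ∃ PM : ProbabilityMeasure (CurveClass ℂ),
        ((PM : ProbabilityMeasure (CurveClass ℂ)) : Measure (CurveClass ℂ)) = P (Dn k) :=
      ⟨⟨P (Dn k), (hPch (Dn k)).1⟩, rfl⟩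
    -- the surrogates along the diagonal subsequence converge to `P (Dn k)`
    have hY : Tendsto (fun j => surrogate Dn an bn (δ' (φ j)) k) atTop (𝓝 PM) := by
      refine ProbabilityMeasure.tendsto_iff_forall_integral_tendsto.2 fun f => ?_
      rw [hPM]
      refine (hPmem (Dn k) (an k) (bn k) (hn k) f).congr' ?_
      filter_upwards [hsφ.eventually (eventually_integral_surrogate (hn k) f)] with j hj
      exact hj.symm
    -- and they are asymptotically at distance `0` from `u (φ j) (Dn k)`
    have hdist : Tendsto (fun j => dist (surrogate Dn an bn (δ' (φ j)) k) (U (φ j) k)) atTop (𝓝 0) := by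
      have hb : ∀ᶠ j in atTop, dist (surrogate Dn an bn (δ' (φ j)) k) (U (φ j) k) ≤
          1 / (((φ j : ℕ) : ℝ) + 1) := by
        filter_upwards [hφ.tendsto_atTop.eventually (eventually_ge_atTop k)] with j hj
        exact (hnm2' (φ j) k hj).le
      exact squeeze_zero' (Eventually.of_forall fun j => dist_nonneg) hb
        (tendsto_one_div_add_atTop_nhds_zero_nat.comp hφ.tendsto_atTop)
    have hUconv : Tendsto (fun j => U (φ j) k) atTop (𝓝 PM) := hY.congr_dist hdist
    intro f
    have h := ProbabilityMeasure.tendsto_iff_forall_integral_tendsto.1 hUconv f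
    simp only [hU, hPM] at h
    exact h
  -- (ii) membership `P ∈ Ω_SAW` and the extension to every domain through the net
  refine ⟨P, ⟨hPch, δ' ∘ φ, fun j => hpos' (φ j), hδ'0.comp hφ.tendsto_atTop, hPmem⟩, φ, hφ,
    fun D f => ?_⟩
  obtain ⟨a, b, hab⟩ := SAW.exists_isEndpointApprox D
  refine Metric.tendsto_nhds.2 fun ε hε => ?_
  obtain ⟨k, hk⟩ := hnet D a b hab f (ε / 3) (by positivity)
  have hu3 : ∀ m, |∫ x, f x ∂(u m D) - ∫ x, f x ∂(u m (Dn k))| ≤ ε / 3 := fun m =>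
    abs_integral_sub_le_of_net (hn k) (u m) (hsu m) (huconv m) hab f hk
  have hP3 : |∫ x, f x ∂(P D) - ∫ x, f x ∂(P (Dn k))| ≤ ε / 3 :=
    abs_integral_sub_le_of_net (hn k) P hsφ hPmem hab f hk
  have hk3 : ∀ᶠ j in atTop, dist (∫ x, f x ∂(u (φ j) (Dn k))) (∫ x, f x ∂(P (Dn k))) < ε / 3 :=
    Metric.tendsto_nhds.1 (hnetconv k f) _ (by positivity)
  filter_upwards [hk3] with j hj
  have hj3 := hu3 (φ j)
  rw [Real.dist_eq] at hj ⊢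
  rw [abs_le] at hj3 hP3
  rw [abs_lt] at hj ⊢
  constructor <;> linarith

/-! ## The composition: the crux BY NAME from the three stubs -/

/-- **`JointCompactness` from (T), (E), (C).** [folklore] -/
theorem JointCompactness_of (hT : Registered.stub_eventualTight) (hE : Registered.stub_endpointRobust)
    (hC : Registered.stub_countableNet) :
    Summit.CriticalPhenomena.SAWScalingLimit.Theses.SAWZoomRigidity.JointCompactness :=
  jointCompactness_iff.2 ⟨partA_of hT hE hC, partB_of hC (partA_of hT hE hC)⟩

/-- Wiring check: the crux BY NAME from the three registered (sorried) stubs — shows the stub theorems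
are exactly the hypotheses of `JointCompactness_of` (this declaration inherits their `sorry`; nothing is
claimed). -/
theorem JointCompactness_wiring :
    Summit.CriticalPhenomena.SAWScalingLimit.Theses.SAWZoomRigidity.JointCompactness :=
  JointCompactness_of stub_eventualTight stub_endpointRobust stub_countableNet

/-! ## Pins and sanity (documentation) -/

/-- (T) is verbatim the shared support item `SAWRestrictionRigidity.EventualTight`
(stmt-CriticalPhenomena-1372). -/
theorem stub_eventualTight_iff_item1372 : Registered.stub_eventualTight ↔ EventualTight :=
  Iff.rfl

/-- **Necessity of (E)**: endpoint robustness is a CONSEQUENCE of conjunct (a) of the crux (both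
approximations converge, along a common further subsequence of any mesh sequence, to the same
`∫ f d(P D)`; `𝓝[>] 0` is countably generated) — so (E) is exactly as safe as the crux. [folklore] -/
theorem endpointRobust_of_partA (hA : PartA) : Registered.stub_endpointRobust := by
  classical
  intro D a b a' b' hab hab' f
  refine tendsto_of_subseq_tendsto fun x hx => ?_
  obtain ⟨hx0, hxpos⟩ := tendsto_nhdsWithin_iff.1 hx
  -- repair the finitely many non-positive terms of `x`
  obtain ⟨x', hx'⟩ : ∃ x' : ℕ → ℝ, ∀ n, x' n = if 0 < x n then x n else 1 := ⟨_, fun _ => rfl⟩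
  have hxx' : ∀ᶠ n in atTop, x' n = x n := by
    filter_upwards [hxpos] with n hn
    rw [hx', if_pos (Set.mem_Ioi.1 hn)]
  have hpos' : ∀ n, 0 < x' n := fun n => by
    rw [hx']
    split_ifs with h
    · exact h
    · exact one_pos
  have hx'0 : Tendsto x' atTop (𝓝 0) := hx0.congr' (EventuallyEq.symm hxx')
  obtain ⟨φ, P, hφ, -, hconv⟩ := hA x' hpos' hx'0
  refine ⟨φ, ?_⟩
  have h1 := (hconv D a b hab f).sub (hconv D a' b' hab' f)
  rw [sub_self] at h1
  refine h1.congr' ?_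
  filter_upwards [hφ.tendsto_atTop.eventually hxx'] with n hn
  rw [← hn]

end Summit.CriticalPhenomena.SAWScalingLimit.Cruxes.JointCompactness.Birth
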